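/-
Copyright (c) 2026 the pub-hodgecm-mathlib formalisation cell (harness21).  Prover seat hodgecm-mathlib-K2E3-p23 (g8), Track B «K2-LIT» ∕ hLiu418 #184♮,
Road I v3, unit U5 «THE CLOSE», FACE-D₀ row `h2₂`, brick (B1c′-2b-i) «THE FINITE CHIRP OF A ONE-PLACE PARAMETER, READ LOCALLY» (LEAD F0P6-plan (g15) BATCH #181 (5);
K2Liu-p02 (g9) (B1c′-1) census 2026-09-05T00:23:59Z; my cut 00:3xZ).  THEOREMS ONLY.
-/
import Summits.HodgeConjecture.HodgeConjecture.Theorems.K2LiuFinChirpTensorSlot     -- ★ p863400 (B1c′-3) `chirpLM_tmul_of_archPart_eq_zero` (+ `finSdChar`, `finMulLM`, `chirpLM`, `archHom`)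
import Literature.NumberTheory.Automorphic.GlobalAdditiveCharacter                   -- ★ `AddChar.adicComponent`
import HarnessLib

/-!
# K2_Liu road (hLiu418 = stmt-HodgeConjecture-24832), U5 «THE CLOSE», FACE-D₀ row `h2₂`, (B1c′-2b-i): THE FINITE SECOND-DEGREE CHARACTER OF A SYMMETRIC
# PARAMETER PLACED AT ONE FINITE PLACE `v` IS THE LOCAL CHARACTER `ψ_{F,v}` OF THE LOCAL QUADRATIC FORM

Cell `pub/hodgecm-mathlib` (D-0151), Track B, build stream 29; helper lane `--supports stmt-HodgeConjecture-24832 --as helper`, count-neutral; closes no socket.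
THEOREMS ONLY (no `def`, no `instance`, no notation, no named-fact hypothesis, no `sorry`).

WHY.  After K2Liu-p02 (g9)'s (B1c′-1) rigidity (a Siegel unipotent `u ∈ N_Δ(𝔸)` acts in the line pair's κ′-model through Weil's chirp `t(S_u^{line})`, ★
`coe_toOp_adelicSiegelLift`) and ★ (B1c′-3) `K2LiuFinChirpTensorSlot.chirpLM_tmul_of_archPart_eq_zero` (a chirp with zero archimedean parameter acts on a pure tensor
`Φ_∞ ⊗ φ` in the FINITE slot by `finMulLM (finSdChar S_f)`), the multiplier representation `ρf` of ★ U2a's line model (letter `hρm` of ★ p863332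
`h2Row_thetaSide_of_finLineModel_conj`) is `ρf z := finMulLM (finSdChar (S_{ι z})_f)` for `z ∈ N_Δ(L⁺_v)` — a parameter SUPPORTED AT ONE PLACE `v`.  THIS FILE reads
such a finite chirp LOCALLY: for `S_v ∈ M_m(F_v)` and `S_f := S_v` placed at `v` (entrywise ★ `finiteAdeleSingleHom F v`),
* §1 `finiteAdeleSingleHom_mul_apply_left ∕ _right` (`x · (s at v) = (x_v s at v)`, Mathlib `RestrictedProduct.mul_single ∕ single_mul`), **`finSdForm_map_finiteAdeleSingleHom`**
  — `q_{S_f}(b) = (q_{S_v}(b_v) at v)`, `b_v i := b i v`;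
* §2 **`finSdChar_map_finiteAdeleSingleHom`** — `finSdChar S_f b = ψ_{F,v}((b_v ᵥ* S_v) ⬝ᵥ b_v)` (★ `finiteAdeleAddChar_apply`, `adeleAddCharAt` ∕ `adicComponent` rfl), and
  **`coe_finMulLM_finSdChar_map_finiteAdeleSingleHom`** — `finMulLM (finSdChar S_f) _ φ = (x ↦ ψ_{F,v}(q_{S_v}(x_v))) · φ`: EXACTLY the shape of U2a's letter
  `hρm : ρf z φ = (fun x => ψ (π (b z) (a • vecMulVec (σ ∘ v x) (v x)))) * φ` with `ψ := ψ_{F,v}`, once (B1c′-2b-ii) reads the local quadratic form `q_{S_v}` as the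
  hermitian Gram pairing `Tr tr(b(X) · a′ G(x))`;
* §3 the ADELIC parameter placed at `v` (`S := S_v` entrywise through ★ `adeleSingleHom F v`): `map_adeleSingleHom_archHom` (`S_∞ = 0`, the hypothesis of ★ (B1c′-3)),
  `map_adeleSingleHom_snd` (`S_f`), and **`chirpLM_map_adeleSingleHom_tmul`** — `t(S)(Φ_∞ ⊗ φ) = Φ_∞ ⊗ ((x ↦ ψ_{F,v}(q_{S_v}(x_v))) · φ)` (★ (B1c′-3) ∘ §2).
References: [Weil1964] A. Weil, Acta Math. 111 (1964) Chap. I n° 13 p. 160, n° 34 p. 184, Chap. III n° 37–38; [CasselsFrohlichANT1967] Tate, Ch. XV §3.2–§4.1 (local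
components of `ψ`); [Kudla1994] §3; [Rallis1984] §4.
HONEST LABEL: HC_CM is proved only modulo the 7 printed citations (2 remaining named inputs: hLiu418 = stmt-HodgeConjecture-24832, h413 = stmt-HodgeConjecture-24833)
until rung 0 closes; this file moves no counter; `h2₂` NOT discharged.
-/

set_option autoImplicit false
set_option linter.dupNamespace false -- the mandated namespace repeats `HodgeConjecture.HodgeConjecture`

noncomputable section

open scoped Matrix TensorProduct SchwartzMap Classical
open NumberField NumberField.mixedEmbedding IsDedekindDomain
open Literature.NumberTheory.Automorphic Literature.NumberTheory.Weil1964

namespace Summit.HodgeConjecture.HodgeConjecture.Cruxes.HLiu418.K2LiuFinChirpLocalReading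

variable (F : Type) [Field F] [NumberField F] (v : HeightOneSpectrum (𝓞 F)) {m : ℕ}

/-! ## §1 The quadratic form of a one-place parameter -/

/-- `x · (s at v) = (x_v · s at v)` in `𝔸_F^∞` (Mathlib `RestrictedProduct.mul_single`). [folklore] -/
theorem mul_finiteAdeleSingleHom (x : FiniteAdeleRing (𝓞 F) F) (s : v.adicCompletion F) :
    x * finiteAdeleSingleHom F v s = finiteAdeleSingleHom F v (x v * s) :=
  (RestrictedProduct.mul_single (fun w : HeightOneSpectrum (𝓞 F) => w.adicCompletionIntegers F) v s x).symm

/-- `(s at v) · x = (s · x_v at v)` in `𝔸_F^∞` (Mathlib `RestrictedProduct.single_mul`). [folklore] -/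
theorem finiteAdeleSingleHom_mul (s : v.adicCompletion F) (x : FiniteAdeleRing (𝓞 F) F) :
    finiteAdeleSingleHom F v s * x = finiteAdeleSingleHom F v (s * x v) :=
  (RestrictedProduct.single_mul (fun w : HeightOneSpectrum (𝓞 F) => w.adicCompletionIntegers F) v s x).symm

/-- **`q_{S_f}(b) = (q_{S_v}(b_v) at v)`**: the finite second-degree form of `S_v` placed at `v` is the local form of the `v`-components, placed at `v`. [cite: Weil1964, Chap. I n° 34 p. 184] -/
theorem finSdForm_map_finiteAdeleSingleHom (S : Matrix (Fin m) (Fin m) (v.adicCompletion F)) (b : Fin m → FiniteAdeleRing (𝓞 F) F) :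
    finSdForm (S.map (finiteAdeleSingleHom F v)) b = finiteAdeleSingleHom F v (((fun i => b i v) ᵥ* S) ⬝ᵥ fun i => b i v) := by
  have hrow : ∀ j, (b ᵥ* S.map (finiteAdeleSingleHom F v)) j = finiteAdeleSingleHom F v (((fun i => b i v) ᵥ* S) j) := by
    intro j
    simp only [Matrix.vecMul, dotProduct, Matrix.map_apply, map_sum]
    exact Finset.sum_congr rfl fun i _ => mul_finiteAdeleSingleHom F v (b i) (S i j)
  rw [finSdForm_apply, dotProduct, dotProduct, map_sum]
  exact Finset.sum_congr rfl fun j _ => by rw [hrow, finiteAdeleSingleHom_mul]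

/-! ## §2 The finite second-degree character of a one-place parameter is the local character of the local form -/

/-- `ψ_f(s at v) = ψ_{F,v}(s)` (`ψ_f = ψ_F(0, ·)`, `ψ_{F,v} = ψ_F ∘ (s ↦ (0, s at v))`; definitional). [cite: CasselsFrohlichANT1967, Ch. XV (Tate), §4.1] -/
theorem finiteAdeleAddChar_finiteAdeleSingleHom (s : v.adicCompletion F) :
    finiteAdeleAddChar F (finiteAdeleSingleHom F v s) = adeleAddCharAt F v s := rfl

/-- **`finSdChar (S_v at v) b = ψ_{F,v}((b_v ᵥ* S_v) ⬝ᵥ b_v)`**: Weil's finite second-degree character of a parameter supported at one place is the local additive character of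
the local quadratic form of the `v`-components. [cite: Weil1964, Chap. I n° 34 p. 184] [cite: CasselsFrohlichANT1967, Ch. XV (Tate), §4.1] -/
theorem finSdChar_map_finiteAdeleSingleHom (S : Matrix (Fin m) (Fin m) (v.adicCompletion F)) (b : Fin m → FiniteAdeleRing (𝓞 F) F) :
    finSdChar (S.map (finiteAdeleSingleHom F v)) b = ((adeleAddCharAt F v (((fun i => b i v) ᵥ* S) ⬝ᵥ fun i => b i v) : Circle) : ℂ) := by
  rw [finSdChar, finSdForm_map_finiteAdeleSingleHom, finiteAdeleAddChar_finiteAdeleSingleHom]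

/-- `adicComponent` spelling of `finSdChar_map_finiteAdeleSingleHom`. [cite: CasselsFrohlichANT1967, Ch. XV (Tate), §4.1] -/
theorem finSdChar_map_finiteAdeleSingleHom' (S : Matrix (Fin m) (Fin m) (v.adicCompletion F)) (b : Fin m → FiniteAdeleRing (𝓞 F) F) :
    finSdChar (S.map (finiteAdeleSingleHom F v)) b = (((adeleAddChar F).adicComponent v (((fun i => b i v) ᵥ* S) ⬝ᵥ fun i => b i v) : Circle) : ℂ) :=
  finSdChar_map_finiteAdeleSingleHom F v S b

/-- **THE `hρm` SHAPE**: multiplication by the finite chirp of a one-place parameter is multiplication by the LOCAL function `x ↦ ψ_{F,v}(q_{S_v}(x_v))`: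
`finMulLM (finSdChar (S_v at v)) _ φ = (x ↦ ψ_{F,v}((x_v ᵥ* S_v) ⬝ᵥ x_v)) · φ`. [cite: Weil1964, Chap. I n° 13 p. 160, n° 34 p. 184] [cite: Rallis1984, §4] -/
theorem coe_finMulLM_finSdChar_map_finiteAdeleSingleHom (S : Matrix (Fin m) (Fin m) (v.adicCompletion F)) (φ : FinSB F (Fin m)) :
    ((finMulLM (finSdChar (S.map (finiteAdeleSingleHom F v))) (isLocallyConstant_finSdChar _) φ : FinSB F (Fin m)) :
        (Fin m → FiniteAdeleRing (𝓞 F) F) → ℂ) =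
      (fun x => ((adeleAddCharAt F v (((fun i => x i v) ᵥ* S) ⬝ᵥ fun i => x i v) : Circle) : ℂ)) *
        (φ : (Fin m → FiniteAdeleRing (𝓞 F) F) → ℂ) := by
  rw [coe_finMulLM]
  funext x
  rw [Pi.mul_apply, finSdChar_map_finiteAdeleSingleHom]

/-! ## §3 The adelic parameter placed at `v`: zero archimedean part, and the chirp on pure tensors -/

/-- the archimedean part of `S_v` placed at `v` vanishes (the hypothesis `hS` of ★ (B1c′-3)). [cite: Weil1964, Chap. III n° 37–38] -/
theorem map_adeleSingleHom_archHom (S : Matrix (Fin m) (Fin m) (v.adicCompletion F)) :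
    (S.map (adeleSingleHom F v)).map (archHom F) = 0 :=
  Matrix.ext fun i j => by rw [Matrix.map_apply, Matrix.map_apply, archHom_apply, adeleSingleHom_apply_fst, map_zero, Matrix.zero_apply]

/-- the finite part of `S_v` placed at `v` in `𝔸_F` is `S_v` placed at `v` in `𝔸_F^∞`. [cite: Weil1964, Chap. III n° 37–38] -/
theorem map_adeleSingleHom_snd (S : Matrix (Fin m) (Fin m) (v.adicCompletion F)) :
    (S.map (adeleSingleHom F v)).map (RingHom.snd (InfiniteAdeleRing F) (FiniteAdeleRing (𝓞 F) F)) = S.map (finiteAdeleSingleHom F v) :=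
  Matrix.ext fun _ _ => rfl

/-- **THE CHIRP OF A ONE-PLACE PARAMETER ON A PURE TENSOR**: `t(S_v at v)(Φ_∞ ⊗ φ) = Φ_∞ ⊗ ((x ↦ ψ_{F,v}(q_{S_v}(x_v))) · φ)` (★ (B1c′-3) at `S_∞ = 0`, then §2).
[cite: Weil1964, Chap. I n° 13 p. 160; Chap. III n° 37–38 pp. 188–190] -/
theorem chirpLM_map_adeleSingleHom_tmul (S : Matrix (Fin m) (Fin m) (v.adicCompletion F)) (Φinf : 𝓢((Fin m → mixedSpace F), ℂ)) (φ : FinSB F (Fin m)) :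
    chirpLM F (S.map (adeleSingleHom F v)) (piSchwartzBruhatEquiv F (Fin m) (Φinf ⊗ₜ[ℂ] φ)) =
      piSchwartzBruhatEquiv F (Fin m) (Φinf ⊗ₜ[ℂ]
        finMulLM (finSdChar (S.map (finiteAdeleSingleHom F v))) (isLocallyConstant_finSdChar _) φ) := by
  rw [K2LiuFinChirpTensorSlot.chirpLM_tmul_of_archPart_eq_zero F _ (map_adeleSingleHom_archHom F v S)]
  congr 2

/-! ## §4 (ED. 2) The finite chirps of an ADDITIVE family of parameters form a multiplier representation — the `ρf` ∃-package of the `hκ` tie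

EDITION 2 (append-only; §§1–3 byte-identical).  K2Liu-p02 (g9) 2026-09-05T00:34:35Z (3): FILE 3's head is stated with the finite chirp `finMulLM (finSdChar ((−⅟2) • cMat q_u)_f)`
on the right, so the `hκ` tie takes the multiplier representation `ρf` BY VALUE with ONE eq-letter `hρf : ∀ z φ, ρf z φ = finMulLM (finSdChar (S z)) _ φ`.  For a family of
finite parameters `S : Z → M_m(𝔸_F^∞)` that is ADDITIVE on the group `Z` (`S 1 = 0`, `S (z w) = S z + S w` — the block coordinate `X` of `N_Δ` is, ★ D9 `unipDelta`, and
`cMat` is linear in it), the chirps multiply (`finSdChar (T + T′) = finSdChar T · finSdChar T′`), so `z ↦ finMulLM (finSdChar (S z))` IS a representation: the ∃-package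
`exists_representation_finMulLM_finSdChar` (no `def` in `Theorems/`). -/

/-- `q_{T + T′} = q_T + q_{T′}`. [folklore] -/
theorem finSdForm_add (T T' : Matrix (Fin m) (Fin m) (FiniteAdeleRing (𝓞 F) F)) (b : Fin m → FiniteAdeleRing (𝓞 F) F) :
    finSdForm (T + T') b = finSdForm T b + finSdForm T' b := by
  rw [finSdForm_apply, finSdForm_apply, finSdForm_apply, Matrix.vecMul_add, add_dotProduct]

/-- `q_0 = 0`. [folklore] -/
theorem finSdForm_zero (b : Fin m → FiniteAdeleRing (𝓞 F) F) : finSdForm (0 : Matrix (Fin m) (Fin m) (FiniteAdeleRing (𝓞 F) F)) b = 0 := by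
  rw [finSdForm_apply, Matrix.vecMul_zero, zero_dotProduct]

/-- **the finite second-degree characters multiply under addition of the parameter**: `finSdChar (T + T′) b = finSdChar T b · finSdChar T′ b`.
[cite: Weil1964, Chap. I n° 2 p. 146, n° 34 p. 184] -/
theorem finSdChar_add (T T' : Matrix (Fin m) (Fin m) (FiniteAdeleRing (𝓞 F) F)) (b : Fin m → FiniteAdeleRing (𝓞 F) F) :
    finSdChar (T + T') b = finSdChar T b * finSdChar T' b := by
  rw [finSdChar, finSdChar, finSdChar, finSdForm_add, AddChar.map_add_eq_mul, Circle.coe_mul]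

/-- `finSdChar 0 = 1`. [cite: Weil1964, Chap. I n° 34 p. 184] -/
theorem finSdChar_zero (b : Fin m → FiniteAdeleRing (𝓞 F) F) : finSdChar (0 : Matrix (Fin m) (Fin m) (FiniteAdeleRing (𝓞 F) F)) b = 1 := by
  rw [finSdChar, finSdForm_zero, AddChar.map_zero_eq_one, Circle.coe_one]

/-- **THE `ρf` ∃-PACKAGE**: for an additive family of finite symmetric parameters `S : Z → M_m(𝔸_F^∞)` on a group `Z` (`S 1 = 0`, `S (z w) = S z + S w`) there is a
representation `ρf` of `Z` on `𝒮((𝔸_F^∞)^m)` with `ρf z = finMulLM (finSdChar (S z))` — multiplication by Weil's finite chirps (the letter `hρf` of the `hκ` tie).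
[cite: Weil1964, Chap. I n° 13 p. 160, n° 34 p. 184] [cite: Rallis1984, §4] -/
theorem exists_representation_finMulLM_finSdChar {Z : Type*} [Group Z] (S : Z → Matrix (Fin m) (Fin m) (FiniteAdeleRing (𝓞 F) F)) (h1 : S 1 = 0)
    (hmul : ∀ z w : Z, S (z * w) = S z + S w) :
    ∃ ρf : Representation ℂ Z (FinSB F (Fin m)), ∀ (z : Z) (φ : FinSB F (Fin m)), ρf z φ = finMulLM (finSdChar (S z)) (isLocallyConstant_finSdChar _) φ := by
  refine ⟨{ toFun := fun z => finMulLM (finSdChar (S z)) (isLocallyConstant_finSdChar _)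
            map_one' := ?_
            map_mul' := fun z w => ?_ }, fun z φ => rfl⟩
  · refine LinearMap.ext fun φ => Subtype.ext (funext fun b => ?_)
    simp only [coe_finMulLM, h1, finSdChar_zero, one_mul, Module.End.one_apply]
  · refine LinearMap.ext fun φ => Subtype.ext (funext fun b => ?_)
    simp only [Module.End.mul_apply, coe_finMulLM, hmul, finSdChar_add, mul_assoc]

end Summit.HodgeConjecture.HodgeConjecture.Cruxes.HLiu418.K2LiuFinChirpLocalReading

end
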